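import Mathlib

/-!
# Stub `cauchyKernel_rayBound` (T2j) of line `Sketch` for crux `WeilComb.CombShapePositivity`
(item stmt-RiemannHypothesis-11229, stub-plan STUB-PLAN-stub_fejer, tier T2 "dilation detection")

For a continuous `f : ℝ → ℂ` whose truncated Laplace transform
`F(z) = ∫_{-2}^{2} f(t) e^{zt} dt` obeys `‖F(z)‖ ≤ C e^{2|Re z|} / (1 + (Im z)²)²`, the Cauchy kernel
`K_f(w,s) = ∫_{-2}^{2} f(t) e^{wt - s} / (s - wt) dt` satisfies, for `w = a + iγ` with `|a| ≤ 1/2`,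
`|γ| ≥ 1`, `Re s ≥ 0` and on the favourable side `|a| |Im s| < |γ| Re s`, the bound
`‖K_f(w,s)‖ ≤ 3C/γ⁴`.

**Proof (ray representation).** For `γ > 0` the hypothesis gives `Im(s/w) < 0`, so for real `t`
`1/(s - wt) = (i/w) ∫_0^∞ e^{iη(t - s/w)} dη` (an absolutely convergent integral of an exponential
with negative real rate `Im(s/w)`). Fubini on `(-2,2] × (0,∞)` gives
`K_f(w,s) = (i/w) e^{-s} ∫_0^∞ e^{-iηs/w} F(w + iη) dη`, and `|i/w| ≤ 1/γ`, `|e^{-s}| ≤ 1`,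
`|e^{-iηs/w}| = e^{η Im(s/w)} ≤ 1`, `|F(w + iη)| ≤ C e / (1 + (γ+η)²)² ≤ C e / (γ² (γ+η)²)`,
`∫_0^∞ (γ+η)⁻² dη = 1/γ`, whence `‖K‖ ≤ C e/γ⁴ ≤ 3C/γ⁴`. The case `γ < 0` is reduced to `γ > 0`
by the substitution `t ↦ -t`, `w ↦ -w` (all hypotheses are invariant).
This is component T2j of STUB-PLAN-stub_fejer (Mathlib only).
-/

noncomputable section

-- the sub-problem path RiemannHypothesis/RiemannHypothesis duplicates a namespace (D-0017)
set_option linter.dupNamespace false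

open scoped Real Topology
open Complex MeasureTheory Set Filter

namespace Summit.RiemannHypothesis.RiemannHypothesis.Theorems.WeilCombBohrFejer

/-- For `γ > 0`, `x ↦ ((γ + x)²)⁻¹` is integrable on `(0, ∞)` with integral `γ⁻¹`
(fundamental theorem of calculus with the antiderivative `-(γ + x)⁻¹`). [folklore] -/
theorem cauchyKernel_rayBound_integral_inv_sq {γ : ℝ} (hγ : 0 < γ) :
    IntegrableOn (fun x : ℝ => ((γ + x) ^ 2)⁻¹) (Ioi 0) ∧
      ∫ x in Ioi (0 : ℝ), ((γ + x) ^ 2)⁻¹ = γ⁻¹ := by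
  have hderiv : ∀ x ∈ Ici (0 : ℝ),
      HasDerivAt (fun y : ℝ => -(γ + y)⁻¹) (((γ + x) ^ 2)⁻¹) x := by
    intro x hx
    have hx0 : γ + x ≠ 0 := (add_pos_of_pos_of_nonneg hγ (Set.mem_Ici.mp hx)).ne'
    have h1 : HasDerivAt (fun y : ℝ => (γ + y)⁻¹) (-((γ + x) ^ 2)⁻¹) x :=
      (hasDerivAt_inv hx0).comp_const_add γ x
    simpa using h1.fun_neg
  have hpos : ∀ x ∈ Ioi (0 : ℝ), 0 ≤ ((γ + x) ^ 2)⁻¹ := fun x _ => by positivity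
  have hlim : Tendsto (fun y : ℝ => -(γ + y)⁻¹) atTop (𝓝 0) := by
    have h1 : Tendsto (fun y : ℝ => γ + y) atTop atTop :=
      tendsto_atTop_add_const_left atTop γ tendsto_id
    simpa using (tendsto_inv_atTop_zero.comp h1).neg
  refine ⟨integrableOn_Ioi_deriv_of_nonneg' hderiv hpos hlim, ?_⟩
  rw [integral_Ioi_of_hasDerivAt_of_nonneg' hderiv hpos hlim]
  simp

/-- The ray bound in the case `Im w ≥ 1` (see the module docstring for the proof). [folklore] -/
theorem cauchyKernel_rayBound_of_im_pos (f : ℝ → ℂ) (C : ℝ) (hf : Continuous f)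
    (hF : ∀ z : ℂ, ‖∫ t in (-2 : ℝ)..2, f t * Complex.exp (z * t)‖ ≤
      C * Real.exp (2 * |z.re|) / (1 + z.im ^ 2) ^ 2)
    (w s : ℂ) (hwre : |w.re| ≤ 1 / 2) (hwim : 1 ≤ w.im) (hsre : 0 ≤ s.re)
    (hfav : |w.re| * |s.im| < w.im * s.re) :
    ‖∫ t in (-2 : ℝ)..2, f t * Complex.exp (w * t - s) / (s - w * t)‖ ≤ 3 * C / w.im ^ 4 := by
  have hγ : 0 < w.im := by linarith
  have hw0 : w ≠ 0 := by
    rintro rfl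
    norm_num at hwim
  have hC : 0 ≤ C := by
    have h0 := hF 0
    norm_num at h0
    exact (norm_nonneg _).trans h0
  -- `q = s / w` has negative imaginary part (this is where the favourable side enters)
  obtain ⟨q, hq⟩ : ∃ q : ℂ, q = s / w := ⟨_, rfl⟩
  have hws : w * q = s := by
    rw [hq]
    field_simp
  have hqim : q.im < 0 := by
    have h1 : s.im * w.re ≤ |w.re| * |s.im| := by
      rw [← abs_mul, mul_comm]
      exact le_abs_self _
    have h2 : s.im * w.re - s.re * w.im < 0 := by linarith
    rw [hq, Complex.div_im, div_sub_div_same]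
    exact div_neg_of_neg_of_pos h2 (Complex.normSq_pos.mpr hw0)
  -- the ray identity `∫_0^∞ e^{iη(t - q)} dη = i/(t - q)`
  have hray : ∀ t : ℝ, ∫ η in Ioi (0 : ℝ), cexp (I * (t - q) * η) = I / (t - q) := by
    intro t
    have hre : (I * (↑t - q)).re < 0 := by simpa using hqim
    rw [integral_exp_mul_complex_Ioi hre 0]
    simp only [Complex.ofReal_zero, mul_zero, Complex.exp_zero]
    rw [div_eq_mul_inv, mul_inv, Complex.inv_I, div_eq_mul_inv]
    ring
  -- the two-variable integrand
  set G : ℝ → ℝ → ℂ :=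
    fun t η => f t * cexp (w * t - s) * (I / w) * cexp (I * (t - q) * η) with hG
  have hpt : ∀ t : ℝ, f t * cexp (w * t - s) / (s - w * t) = ∫ η in Ioi (0 : ℝ), G t η := by
    intro t
    simp only [hG]
    rw [integral_const_mul, hray t]
    have hI : I / w * (I / (↑t - q)) = 1 / (s - w * ↑t) := by
      rw [div_mul_div_comm, Complex.I_mul_I, mul_sub, hws]
      rw [show s - w * ↑t = -(w * ↑t - s) by ring, div_neg, neg_div]
    rw [mul_assoc (f t * cexp (w * t - s)), hI, mul_one_div]
  -- integrability on `uIoc (-2) 2 × Ioi 0` (product bound `A(t) e^{η Im q}`)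
  have hint : Integrable (Function.uncurry G)
      ((volume.restrict (Set.uIoc (-2 : ℝ) 2)).prod (volume.restrict (Ioi (0 : ℝ)))) := by
    have hcont : Continuous (Function.uncurry G) := by
      have : Continuous fun p : ℝ × ℝ => G p.1 p.2 := by
        simp only [hG]
        fun_prop
      exact this
    have hA : Integrable (fun t : ℝ => ‖f t * cexp (w * t - s) * (I / w)‖)
        (volume.restrict (Set.uIoc (-2 : ℝ) 2)) :=
      (Continuous.integrableOn_uIoc (by fun_prop)).norm
    have hB : Integrable (fun η : ℝ => Real.exp (q.im * η)) (volume.restrict (Ioi (0 : ℝ))) :=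
      integrableOn_exp_mul_Ioi hqim 0
    refine Integrable.mono' (hA.mul_prod hB) hcont.aestronglyMeasurable (ae_of_all _ ?_)
    rintro ⟨t, η⟩
    simp only [Function.uncurry_apply_pair, hG]
    rw [norm_mul, Complex.norm_exp]
    have : (I * (↑t - q) * ↑η).re = q.im * η := by
      simp only [Complex.mul_re, Complex.mul_im, Complex.I_re, Complex.I_im, Complex.sub_re,
        Complex.sub_im, Complex.ofReal_re, Complex.ofReal_im]
      ring
    rw [this]
  -- Fubini
  rw [show (fun t : ℝ => f t * cexp (w * t - s) / (s - w * t)) =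
      fun t => ∫ η in Ioi (0 : ℝ), G t η from funext hpt,
    intervalIntegral_integral_swap hint]
  -- the inner integral is `e^{-s} e^{-iqη} (i/w) F(w + iη)`
  have hinner : ∀ η : ℝ, ∫ t in (-2 : ℝ)..2, G t η =
      cexp (-s) * cexp (-(I * q * η)) * (I / w) *
        ∫ t in (-2 : ℝ)..2, f t * cexp ((w + I * η) * t) := by
    intro η
    rw [← intervalIntegral.integral_const_mul]
    apply intervalIntegral.integral_congr
    intro t _
    simp only [hG]
    have e1 : cexp (w * t - s) * cexp (I * (t - q) * η) =
        cexp (-s) * cexp (-(I * q * η)) * cexp ((w + I * η) * t) := by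
      rw [← Complex.exp_add, ← Complex.exp_add, ← Complex.exp_add]
      congr 1
      ring
    calc f t * cexp (w * t - s) * (I / w) * cexp (I * (t - q) * η)
        = f t * (I / w) * (cexp (w * t - s) * cexp (I * (t - q) * η)) := by ring
      _ = cexp (-s) * cexp (-(I * q * η)) * (I / w) * (f t * cexp ((w + I * η) * t)) := by
          rw [e1]; ring
  obtain ⟨hint2, hval⟩ := cauchyKernel_rayBound_integral_inv_sq hγ
  -- pointwise bound of the inner integral
  have hbound : ∀ η ∈ Ioi (0 : ℝ), ‖cexp (-s) * cexp (-(I * q * η)) * (I / w) *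
      ∫ t in (-2 : ℝ)..2, f t * cexp ((w + I * η) * t)‖ ≤
      C * Real.exp 1 / w.im ^ 3 * ((w.im + η) ^ 2)⁻¹ := by
    intro η hη
    have hη' : 0 < η := hη
    obtain ⟨u, hu⟩ : ∃ u : ℝ, u = w.im + η := ⟨_, rfl⟩
    rw [← hu]
    have hu0 : 0 < u := by rw [hu]; linarith
    have hγu : w.im ^ 2 ≤ u ^ 2 := by rw [hu]; nlinarith
    have h1 : ‖cexp (-s)‖ ≤ 1 := by
      rw [Complex.norm_exp, Real.exp_le_one_iff, Complex.neg_re]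
      linarith
    have h2 : ‖cexp (-(I * q * η))‖ ≤ 1 := by
      rw [Complex.norm_exp, Real.exp_le_one_iff]
      have : (-(I * q * ↑η)).re = q.im * η := by
        simp only [Complex.neg_re, Complex.mul_re, Complex.mul_im, Complex.I_re, Complex.I_im,
          Complex.ofReal_re, Complex.ofReal_im]
        ring
      rw [this]
      nlinarith
    have h3 : ‖I / w‖ ≤ 1 / w.im := by
      rw [norm_div, Complex.norm_I]
      apply one_div_le_one_div_of_le hγ
      have := Complex.abs_im_le_norm w
      rwa [abs_of_pos hγ] at this
    have h4 : ‖∫ t in (-2 : ℝ)..2, f t * cexp ((w + I * η) * t)‖ ≤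
        C * Real.exp 1 / (1 + u ^ 2) ^ 2 := by
      have h := hF (w + I * η)
      have hre : (w + I * ↑η).re = w.re := by simp
      have him : (w + I * ↑η).im = u := by rw [hu]; simp
      rw [hre, him] at h
      refine h.trans ?_
      refine div_le_div_of_nonneg_right ?_ (by positivity)
      refine mul_le_mul_of_nonneg_left ?_ hC
      exact Real.exp_le_exp.mpr (by linarith [abs_nonneg w.re])
    calc ‖cexp (-s) * cexp (-(I * q * η)) * (I / w) *
          ∫ t in (-2 : ℝ)..2, f t * cexp ((w + I * η) * t)‖
        = ‖cexp (-s)‖ * ‖cexp (-(I * q * η))‖ * ‖I / w‖ *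
            ‖∫ t in (-2 : ℝ)..2, f t * cexp ((w + I * η) * t)‖ := by
          rw [norm_mul, norm_mul, norm_mul]
      _ ≤ 1 * 1 * (1 / w.im) * (C * Real.exp 1 / (1 + u ^ 2) ^ 2) := by gcongr
      _ = C * Real.exp 1 / w.im * (1 / (1 + u ^ 2) ^ 2) := by ring
      _ ≤ C * Real.exp 1 / w.im * (1 / (w.im ^ 2 * u ^ 2)) := by
          refine mul_le_mul_of_nonneg_left ?_ (by positivity)
          apply one_div_le_one_div_of_le (by positivity)
          nlinarith [mul_nonneg (sq_nonneg u) (sub_nonneg.mpr hγu), sq_nonneg u]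
      _ = C * Real.exp 1 / w.im ^ 3 * (u ^ 2)⁻¹ := by ring
  -- integrate the bound
  calc ‖∫ η in Ioi (0 : ℝ), ∫ t in (-2 : ℝ)..2, G t η‖
      = ‖∫ η in Ioi (0 : ℝ), cexp (-s) * cexp (-(I * q * η)) * (I / w) *
          ∫ t in (-2 : ℝ)..2, f t * cexp ((w + I * η) * t)‖ := by
        simp_rw [hinner]
    _ ≤ ∫ η in Ioi (0 : ℝ), C * Real.exp 1 / w.im ^ 3 * ((w.im + η) ^ 2)⁻¹ := by
        apply norm_integral_le_of_norm_le (Integrable.const_mul hint2 _)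
        exact (ae_restrict_iff' measurableSet_Ioi).mpr (ae_of_all _ hbound)
    _ = C * Real.exp 1 / w.im ^ 3 * w.im⁻¹ := by rw [integral_const_mul, hval]
    _ = C * Real.exp 1 / w.im ^ 4 := by ring
    _ ≤ 3 * C / w.im ^ 4 := by
        refine div_le_div_of_nonneg_right ?_ (by positivity)
        nlinarith [Real.exp_one_lt_d9, hC]

/-- **Ray bound for the Cauchy kernel** (stub `cauchyKernel_rayBound`, T2j of
STUB-PLAN-stub_fejer): if `‖∫_{-2}^{2} f e^{zt}‖ ≤ C e^{2|Re z|}/(1 + (Im z)²)²` for all `z`, then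
for `|Re w| ≤ 1/2`, `|Im w| ≥ 1`, `Re s ≥ 0` and `|Re w| |Im s| < |Im w| Re s`,
`‖∫_{-2}^{2} f(t) e^{wt-s}/(s - wt) dt‖ ≤ 3C/|Im w|⁴`. The case `Im w < 0` is reduced to
`Im w > 0` by `t ↦ -t`, `w ↦ -w`. [folklore] -/
theorem cauchyKernel_rayBound : ∀ (f : ℝ → ℂ) (C : ℝ), Continuous f →
    (∀ z : ℂ, ‖∫ t in (-2 : ℝ)..2, f t * Complex.exp (z * t)‖ ≤
      C * Real.exp (2 * |z.re|) / (1 + z.im ^ 2) ^ 2) →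
    ∀ w s : ℂ, |w.re| ≤ 1 / 2 → 1 ≤ |w.im| → 0 ≤ s.re → |w.re| * |s.im| < |w.im| * s.re →
    ‖∫ t in (-2 : ℝ)..2, f t * Complex.exp (w * t - s) / (s - w * t)‖ ≤ 3 * C / |w.im| ^ 4 := by
  intro f C hf hF w s hwre hwim hsre hfav
  rcases le_or_gt 0 w.im with hpos | hneg
  · rw [abs_of_nonneg hpos] at hwim hfav ⊢
    exact cauchyKernel_rayBound_of_im_pos f C hf hF w s hwre hwim hsre hfav
  · rw [abs_of_neg hneg] at hwim hfav ⊢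
    -- reflect `t ↦ -t`, `w ↦ -w`
    have hF' : ∀ z : ℂ, ‖∫ t in (-2 : ℝ)..2, f (-t) * Complex.exp (z * t)‖ ≤
        C * Real.exp (2 * |z.re|) / (1 + z.im ^ 2) ^ 2 := by
      intro z
      have h := intervalIntegral.integral_comp_neg (a := -2) (b := 2)
        (fun t : ℝ => f t * cexp (-z * t))
      simp only [neg_neg, Complex.ofReal_neg, mul_neg, neg_mul] at h
      rw [h]
      have h2 := hF (-z)
      simp only [Complex.neg_re, Complex.neg_im, abs_neg, neg_sq, neg_mul] at h2
      exact h2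
    have key := cauchyKernel_rayBound_of_im_pos (fun t => f (-t)) C (hf.comp continuous_neg)
      hF' (-w) s (by simpa using hwre) (by simpa using hwim) hsre (by simpa using hfav)
    have hsub : ∫ t in (-2 : ℝ)..2, f t * cexp (w * t - s) / (s - w * t) =
        ∫ t in (-2 : ℝ)..2, f (-t) * cexp (-w * t - s) / (s - -w * t) := by
      have h := intervalIntegral.integral_comp_neg (a := -2) (b := 2)
        (fun t : ℝ => f t * cexp (w * t - s) / (s - w * t))
      simp only [neg_neg, Complex.ofReal_neg, mul_neg] at h
      rw [← h]
      simp only [neg_mul]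
    rw [hsub]
    simpa using key

end Summit.RiemannHypothesis.RiemannHypothesis.Theorems.WeilCombBohrFejer

end
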